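import Literature.MathematicalPhysics.QuantumFieldTheory.Balaban1983to89.B9Eq326LocalPartKatoForm
import Literature.MathematicalPhysics.QuantumFieldTheory.Balaban1983to89.B9Eq342SupNormBootstrapLinf

/-!
# `Balaban1983to89.B9Eq326LocalPartSupBound` — T. Bałaban, *Propagators for lattice gauge theories in a background field*, Commun. Math. Phys. **99**
# (1985) 389–434 [Balaban1985BackgroundPropagators] Thm 3.3 (3.47) p. 398 with (3.26) p. 395, (3.10) p. 392, (3.35) p. 396 and [Balaban1985Variational]
# (134)–(136) p. 298: **THE VALUE ROW (SUP NORM) OF THE INVERSE OF THE LOCAL PART `A₀ = Δ(U) + D_UD*_U + aQ*Q` OF `Δ_a` — `‖(A₀⁻¹f)(b)‖ ≤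
# (2 + (2p₂ + C₃)·C_E·√μ)∕(1 − 2(p′_∞ + p″_∞))·sup|f|` CLOSED-FORM IN SIX DISPLAYED LETTERS**, by Kato domination on the BOND graph (the local part in
# Kato form, `B9Eq326LocalPartKatoForm.kato_form_localPart`) and the `L^∞ → L^∞` bootstrap `B9Eq342SupNormBootstrapLinf` — stone (I0) of the NE9 owner's
# plan v11 («storey G₁ by Woodbury around A₀», `t4/b2b-balaban-t4-ne9-p1/g91/PLAN-V11-STOREY-G1.md` §1∕§3): the first of the four primitive rows the
# Woodbury form `G₁ = A₀⁻¹ + A₀⁻¹C*S⁻¹CA₀⁻¹` (`B9Eq326WoodburySchur.G1ofU_eq_woodbury`) asks for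

statement-level skeleton of published theorems with citation tags; proofs where landed; nothing here is a claim about the Yang–Mills mass gap

CITATION HEADER (lean-in-tree rule).  Audit cell `pub-balaban`, sub-cell `t4`, BINDER row NE9; filed by the NE9 BINDER-row OWNER lineage
`b2b-balaban-t4-ne9-p1` (gen 92).  Imports: `B9Eq326LocalPartKatoForm` (this lineage g92: `A₀` in Kato form) and `B9Eq342SupNormBootstrapLinf` (g91: the
bootstrap with an `L^∞ → L^∞` perturbation letter).  Sources READ first-hand (`paper:balaban1985-cmp99-background-propagators`, journal page = PDF page +
388): p. 398 Thm 3.3 *«all the operators G′(U), (Q′G′(U)²Q′*)⁻¹, G(U), (QG(U)Q*)⁻¹ satisfy (3.42)–(3.45) …»* with (3.47); p. 395 (3.26); p. 396 (3.35); p. 398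
*«We will prove the above theorem by constructing a random walk representation»* — NOTHING of that proof is reproduced: the cell's substitute is positivity
(Kato domination, [DodziukMathai2006] §1 BY NAME through `B9Eq323KatoDomination` ∕ `B9Eq342SupNormBootstrap`).  [Balaban1985Variational] p. 298 *«This way
we have expressed (Δ + DRD*)A₀ as a sum of Δ_{U₀}A₀ and a bounded operator acting on A₀. The bound for this operator follows from the inequality (3.49) [5]
for DPD*, the inequality (3.69) [5] for Δ′, and the regularity condition (14)»* — the two `L^∞ → L^∞` letters `p′_∞` (for `Δ′`) and `p″_∞` (for `η⁻²𝒦`) below.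

WHAT IS PROVED (sorry-free; 0 `def`; [folklore] composition BY NAME).  Data: any periodic lattice `Pd`, fibre `W ≃ 𝔸` (`φ`), weight `c₀`, background `U`,
scalars `η`, `a`, trace datum `τ`, averaging `Q`, and `A₀ = hessOp φ η U τ + D_U∘D*_U + Q†(a•Q)` (the `hA₀` letter of `B9Eq326WoodburySchur`) with a
DISPLAYED positivity witness `hpos₀` (dischargeable from Thm 3.11's `hpos` by `B9Eq326WoodburySchur.local_pos_of_pos`), `A₀⁻¹ := greenK A₀ hpos₀`.  Letters:
(T) contraction of the transporters on the fibre; (PΔ′) `‖(Δ′v)(b)‖ ≤ p′_∞·sup‖v‖` ([B9] (3.69) ∕ `B9Eq310Hermitian.norm_deltaPrimeOp_le` on the abstract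
model — DISPLAYED here); (P𝒦) `‖(η⁻²𝒦v)(b)‖ ≤ p″_∞·sup‖v‖` (INHABITED in §2 from `B11Eq135WeitzenbockCarrier.norm_weitzOp_apply_le` and a holonomy letter);
(P₂) `‖(Q†(a•Q)v)(b)‖ ≤ p₂‖v‖_{L²}` (block-local penalty); (E₀) `‖A₀⁻¹g‖ ≤ C_E‖g‖`; (FS) the flat scalar double-resolvent letter `C₃` ON THE SITE GRAPH
(weight `η⁻²`, mass `1` — §0 lifts it to the bond graph, component by component); (supp) `‖f(b)‖ ≤ F`, `‖f‖ ≤ √μ·F`; smallness `2(p′_∞ + p″_∞) < 1`.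
* §0 `hFS_bond_of_site` — the flat letter on the bond graph `(x, μ) ∼ (x ± e_ν, μ)` from the site letter (the graph is `d` copies of the site graph).
* §1 **`norm_localInv_apply_le`** — `‖(A₀⁻¹f)(b)‖ ≤ (2 + (2p₂ + C₃)·C_E·√μ)∕(1 − 2(p′_∞ + p″_∞))·F` at every bond.
* §2 **`hPK_of_holonomy`** — (P𝒦) INHABITED: holonomy letter `‖(S(w,ν)R(w,μ) − R(x,μ)S(z,ν))v‖ ≤ δ‖v‖` (`μ ≠ ν`, `δ ≥ 0`) ⟹ `p″_∞ = η⁻²(d−1)δ`;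
  **`norm_localInv_apply_le_unitary`** — (T) replaced by the chain's standing letters (unitary `U`, `*`-trace, compatible fibre norm).
HONEST SCOPE.  Composition; the letters are HYPOTHESES (inhabited ∕ inhabitable elsewhere: (E₀) = coercivity of `A₀ ≥ Δ_a ≥ γ₁`, Thm 3.11 currency; (FS) =
`B5Eq129FreeResolventSupBoundSites`; (PΔ′) = (3.69); (P𝒦) §2; (P₂) one Cauchy–Schwarz on a block); VALUE row only — no decay (storey (D) species), no
∇-row; nothing of [B9] Thm 3.1∕3.3∕3.11 asserted, valued or discharged; «NE9 ⇐ the named binders»; NE9 NOT PRINTED ∕ NOT PROVED; row WALLED ON A MODEL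
(O-NE9-1; #5 UNRULED); spine PROVED 0∕9; rung (B)+1 on a finite T⁴ — NOT infinite volume, NOT mass gap, NOT BetaPertH, NOT Clay.  HONEST DEPENDENCY: continuum YM
on T⁴ ⇐ BetaPertH ∧ nine spine estimates (0/9 proved); BetaPertH ⇐ (D1) ∧ (D4) ∧ CAP+tail.  NEW file; nothing modified.  Net new unproved facts: 0.
-/

noncomputable section

open scoped InnerProductSpace ComplexConjugate BigOperators

namespace Literature.MathematicalPhysics.QuantumFieldTheory.Balaban1983to89.B9Eq326LocalPartSupBound

open B9SectCLatticeCarrier (Bond shift unshift)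
open B4Sect5Torus (TSite)
open B9Eq311L2Pairing (WL2)
open B11Eq103H1Complex (BondL2K greenK apply_greenK covDerivL2K covDivL2K)
open B9Eq310HessianOperator (adTransportW curvOp hessOp)
open B11Eq135WeitzenbockCarrier (weitzOp norm_weitzOp_apply_le)
open B9Eq326LocalPartKatoForm (weitzOpK equiv_weitzOpK kato_form_localPart)
open B9Eq342GreenPrimeSupBound (adTransportW_inv_adTransportW norm_adTransportW_eq norm_adTransportW_inv_eq)
open B9Eq342SupNormBootstrapLinf (norm_le_of_kato_bootstrap_linf)

/-! ## §0 The flat double-resolvent letter on the bond graph from the site letter -/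

section Flat

variable {d : ℕ} {Pd : Fin d → ℕ}

/-- On the bond graph `(x, μ) ∼ (x ± e_ν, μ)` the neighbour maps preserve the component `μ`. [folklore]
[cite: Balaban1985BackgroundPropagators, (3.23) p.394] -/
theorem nbr_bond_eq (x : TSite d Pd) (μ : Fin d) (j : Fin d ⊕ Fin d) :
    Sum.elim (fun ν => (unshift ν x, μ)) (fun ν => (shift ν x, μ)) j = (Sum.elim (fun ν => unshift ν x) (fun ν => shift ν x) j, μ) := by
  rcases j with ν | ν <;> rfl

/-- **THE FLAT LETTER (FS) ON THE BOND GRAPH FROM THE SITE GRAPH**: the bond graph `(x, μ) ∼ (x ± e_ν, μ)` (weight `w₀`, mass `m`) is `d` disjoint copies of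
the site graph, so a scalar double-resolvent bound `φ₂(x) ≤ C₃·√(Σ_y c·ψ(y)²)` on sites (`C₃ ≥ 0`, `c ≥ 0`) gives the same bound on bonds, component by
component, the slice sum dominated by the full sum. [folklore] [cite: Balaban1985BackgroundPropagators, (3.23) p.394, (3.39) p.397] -/
theorem hFS_bond_of_site {w₀ m C₃ c : ℝ} (hC₃ : 0 ≤ C₃) (hc : 0 ≤ c)
    (hFS : ∀ ψ φ₁ φ₂ : TSite d Pd → ℝ, (∀ x, 0 ≤ ψ x) →
      (∀ x, ∑ j : Fin d ⊕ Fin d, w₀ * (φ₁ x - φ₁ (Sum.elim (fun ν => unshift ν x) (fun ν => shift ν x) j)) + m * φ₁ x = ψ x) →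
      (∀ x, ∑ j : Fin d ⊕ Fin d, w₀ * (φ₂ x - φ₂ (Sum.elim (fun ν => unshift ν x) (fun ν => shift ν x) j)) + m * φ₂ x = φ₁ x) →
      ∀ x, φ₂ x ≤ C₃ * Real.sqrt (∑ y, c * ψ y ^ 2))
    (ψ φ₁ φ₂ : Bond d Pd → ℝ) (hψ : ∀ b, 0 ≤ ψ b)
    (h₁ : ∀ b, ∑ j : Fin d ⊕ Fin d, w₀ * (φ₁ b - φ₁ (Sum.elim (fun ν => (unshift ν b.1, b.2)) (fun ν => (shift ν b.1, b.2)) j)) + m * φ₁ b = ψ b)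
    (h₂ : ∀ b, ∑ j : Fin d ⊕ Fin d, w₀ * (φ₂ b - φ₂ (Sum.elim (fun ν => (unshift ν b.1, b.2)) (fun ν => (shift ν b.1, b.2)) j)) + m * φ₂ b = φ₁ b)
    (b : Bond d Pd) : φ₂ b ≤ C₃ * Real.sqrt (∑ b' : Bond d Pd, c * ψ b' ^ 2) := by
  obtain ⟨x, μ⟩ := b
  -- the slice at the component `μ`
  have hs := hFS (fun y => ψ (y, μ)) (fun y => φ₁ (y, μ)) (fun y => φ₂ (y, μ)) (fun y => hψ _)
    (fun y => by simpa only [nbr_bond_eq] using h₁ (y, μ)) (fun y => by simpa only [nbr_bond_eq] using h₂ (y, μ)) x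
  refine hs.trans (mul_le_mul_of_nonneg_left (Real.sqrt_le_sqrt ?_) hC₃)
  rw [Fintype.sum_prod_type]
  exact Finset.sum_le_sum fun y _ =>
    Finset.single_le_sum (f := fun ν => c * ψ (y, ν) ^ 2) (fun ν _ => mul_nonneg hc (sq_nonneg _)) (Finset.mem_univ μ)

end Flat

/-! ## §1 The value row of `A₀⁻¹` -/

section Instance

variable {d : ℕ} {Pd : Fin d → ℕ} {𝔸 : Type*} [Ring 𝔸] [StarRing 𝔸] [Algebra ℂ 𝔸] [StarModule ℂ 𝔸]
  {W : Type*} [NormedAddCommGroup W] [InnerProductSpace ℂ W] [FiniteDimensional ℂ W] (φ : W ≃ₗ[ℂ] 𝔸) {c₀ : ℝ} [Fact (0 < c₀)]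
  (η : ℝ) (U : Bond d Pd → 𝔸ˣ) (τ : 𝔸 →ₗ[ℂ] ℂ) {F' : Type*} [NormedAddCommGroup F'] [InnerProductSpace ℂ F'] [FiniteDimensional ℂ F']
  (Q : BondL2K ℂ d Pd c₀ W →ₗ[ℂ] F') (a : ℝ)

omit [FiniteDimensional ℂ W] in
/-- Bookkeeping: the weighted `L²` norm (3.11) on bonds IS `√(Σ_b c₀‖v(b)‖²)`. [cite: Balaban1985BackgroundPropagators, (3.11) p.392] -/
theorem norm_eq_sqrt_sum (v : BondL2K ℂ d Pd c₀ W) : ‖v‖ = Real.sqrt (∑ b, c₀ * ‖WL2.equiv ℂ _ W v b‖ ^ 2) := by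
  rw [← WL2.norm_sq, Real.sqrt_sq (norm_nonneg _)]

/-- **THE VALUE ROW OF `A₀⁻¹`, CLOSED-FORM IN THE LETTERS.**  `A₀ = Δ(U) + D_UD*_U + Q†(a•Q)` (3.26)'s local part, positive (`hpos₀`), `A₀⁻¹ = greenK A₀ hpos₀`;
(T) contractive transporters; (PΔ′) `‖(Δ′v)(b)‖ ≤ p′_∞·sup‖v‖`; (P𝒦) `‖(η⁻²𝒦v)(b)‖ ≤ p″_∞·sup‖v‖`; (P₂) `‖(Q†(a•Q)v)(b)‖ ≤ p₂‖v‖`; (E₀) `‖A₀⁻¹g‖ ≤ C_E‖g‖`;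
(FS) the flat site letter `C₃` (weight `η⁻²`, mass `1`, `L²`-weight `c₀`); data `‖f(b)‖ ≤ F`, `‖f‖ ≤ √μ·F`; `2(p′_∞ + p″_∞) < 1`.  Then at every bond
`‖(A₀⁻¹f)(b)‖ ≤ (2 + (2p₂ + C₃)·C_E·√μ)∕(1 − 2(p′_∞ + p″_∞))·F` — the (3.47)-type sup row of the LOCAL part, every such background.
[cite: Balaban1985BackgroundPropagators, Thm 3.3 (3.47) p.398, (3.26) p.395, (3.10) p.392; Balaban1985Variational, (134)–(136) p.298; DodziukMathai2006, Lemma 1.1 §1] -/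
theorem norm_localInv_apply_le
    (hR : ∀ b w, ‖adTransportW φ U b w‖ ≤ ‖w‖) (hS : ∀ b w, ‖adTransportW φ (fun b => (U b)⁻¹) b w‖ ≤ ‖w‖)
    (A₀ : BondL2K ℂ d Pd c₀ W →ₗ[ℂ] BondL2K ℂ d Pd c₀ W)
    (hA₀ : A₀ = hessOp φ η U τ + covDerivL2K ℂ c₀ ((η : ℂ))⁻¹ (adTransportW φ U) ∘ₗ covDivL2K ℂ c₀ ((η : ℂ))⁻¹ (adTransportW φ fun b => (U b)⁻¹) +
      LinearMap.adjoint Q ∘ₗ ((a : ℂ) • Q))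
    (hpos₀ : ∀ x : BondL2K ℂ d Pd c₀ W, x ≠ 0 → 0 < RCLike.re ⟪x, A₀ x⟫_ℂ)
    {pΔ pK p₂ CE C₃ : ℝ} (hp₂ : 0 ≤ p₂) (hCE : 0 ≤ CE) (hC₃ : 0 ≤ C₃) (hsmall : 2 * (pΔ + pK) < 1)
    (hPΔ : ∀ (v : BondL2K ℂ d Pd c₀ W) (b : Bond d Pd),
      ‖WL2.equiv ℂ _ W (curvOp φ τ η U v) b‖ ≤ pΔ * ⨆ b', ‖WL2.equiv ℂ _ W v b'‖)
    (hPK : ∀ (v : BondL2K ℂ d Pd c₀ W) (b : Bond d Pd),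
      ‖WL2.equiv ℂ _ W ((((η : ℂ))⁻¹ * ((η : ℂ))⁻¹) • weitzOpK ℂ c₀ (adTransportW φ U) (adTransportW φ fun b => (U b)⁻¹) v) b‖ ≤
        pK * ⨆ b', ‖WL2.equiv ℂ _ W v b'‖)
    (hP₂ : ∀ (v : BondL2K ℂ d Pd c₀ W) (b : Bond d Pd), ‖WL2.equiv ℂ _ W ((LinearMap.adjoint Q ∘ₗ ((a : ℂ) • Q)) v) b‖ ≤ p₂ * ‖v‖)
    (hE : ∀ g, ‖greenK A₀ hpos₀ g‖ ≤ CE * ‖g‖)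
    (hFS : ∀ ψ φ₁ φ₂ : TSite d Pd → ℝ, (∀ x, 0 ≤ ψ x) →
      (∀ x, ∑ j : Fin d ⊕ Fin d, (η⁻¹) ^ 2 * (φ₁ x - φ₁ (Sum.elim (fun ν => unshift ν x) (fun ν => shift ν x) j)) + 1 * φ₁ x = ψ x) →
      (∀ x, ∑ j : Fin d ⊕ Fin d, (η⁻¹) ^ 2 * (φ₂ x - φ₂ (Sum.elim (fun ν => unshift ν x) (fun ν => shift ν x) j)) + 1 * φ₂ x = φ₁ x) →
      ∀ x, φ₂ x ≤ C₃ * Real.sqrt (∑ y, c₀ * ψ y ^ 2))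
    (f : BondL2K ℂ d Pd c₀ W) {F μ : ℝ} (hF : ∀ b, ‖WL2.equiv ℂ _ W f b‖ ≤ F) (hμ : ‖f‖ ≤ Real.sqrt μ * F) (b : Bond d Pd) :
    ‖WL2.equiv ℂ _ W (greenK A₀ hpos₀ f) b‖ ≤ (2 + (2 * p₂ + C₃) * CE * Real.sqrt μ) / (1 - 2 * (pΔ + pK)) * F := by
  subst hA₀
  -- the solution, the zeroth-order remainder `q = (Δ′ + Q†(a•Q) − η⁻²𝒦)u`, and the Kato form `Σ_j η⁻²(u − Tu) = f − q`
  set u : BondL2K ℂ d Pd c₀ W := greenK _ hpos₀ f with hu_def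
  set q : BondL2K ℂ d Pd c₀ W := (curvOp φ τ η U + LinearMap.adjoint Q ∘ₗ ((a : ℂ) • Q) -
    (((η : ℂ))⁻¹ * ((η : ℂ))⁻¹) • weitzOpK ℂ c₀ (adTransportW φ U) (adTransportW φ fun b => (U b)⁻¹) :
      BondL2K ℂ d Pd c₀ W →ₗ[ℂ] BondL2K ℂ d Pd c₀ W) u with hq_def
  have hsol := apply_greenK hpos₀ f
  let nbr : Bond d Pd → Fin d ⊕ Fin d → Bond d Pd := fun b j => Sum.elim (fun ν => (unshift ν b.1, b.2)) (fun ν => (shift ν b.1, b.2)) j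
  let T : Bond d Pd → Fin d ⊕ Fin d → W →ₗ[ℂ] W :=
    fun b j => Sum.elim (fun ν => adTransportW φ (fun b => (U b)⁻¹) (unshift ν b.1, ν)) (fun ν => adTransportW φ U (b.1, ν)) j
  have hT : ∀ b j v, ‖T b j v‖ ≤ ‖v‖ := fun b j v => by
    rcases j with ν | ν
    · exact hS _ v
    · exact hR _ v
  have hu : ∀ b, ∑ j, (RCLike.ofReal ((η⁻¹) ^ 2) : ℂ) • (WL2.equiv ℂ _ W u b - T b j (WL2.equiv ℂ _ W u (nbr b j))) =
      WL2.equiv ℂ _ W f b - WL2.equiv ℂ _ W q b := by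
    intro b
    have h := kato_form_localPart φ η U τ Q a (c₀ := c₀) u b
    rw [← hu_def] at hsol
    rw [hsol] at h
    exact h
  -- the remainder in the `L^∞ → L^∞` currency: `‖q(b)‖ ≤ (p′_∞ + p″_∞)·sup‖u‖ + p₂‖u‖`
  have hq : ∀ b, ‖WL2.equiv ℂ _ W q b‖ ≤ (pΔ + pK) * (⨆ b', ‖WL2.equiv ℂ _ W u b'‖) + p₂ * ‖u‖ := by
    intro b
    have e : WL2.equiv ℂ _ W q b = WL2.equiv ℂ _ W (curvOp φ τ η U u) b + WL2.equiv ℂ _ W ((LinearMap.adjoint Q ∘ₗ ((a : ℂ) • Q)) u) b -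
        WL2.equiv ℂ _ W ((((η : ℂ))⁻¹ * ((η : ℂ))⁻¹) • weitzOpK ℂ c₀ (adTransportW φ U) (adTransportW φ fun b => (U b)⁻¹) u) b := by
      rw [hq_def]
      simp only [LinearMap.sub_apply, LinearMap.add_apply, LinearMap.smul_apply, WL2.equiv_sub, WL2.equiv_add, Pi.sub_apply, Pi.add_apply]
    rw [e]
    calc _ ≤ ‖WL2.equiv ℂ _ W (curvOp φ τ η U u) b + WL2.equiv ℂ _ W ((LinearMap.adjoint Q ∘ₗ ((a : ℂ) • Q)) u) b‖ +
          ‖WL2.equiv ℂ _ W ((((η : ℂ))⁻¹ * ((η : ℂ))⁻¹) • weitzOpK ℂ c₀ (adTransportW φ U) (adTransportW φ fun b => (U b)⁻¹) u) b‖ :=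
        norm_sub_le _ _
      _ ≤ (pΔ * (⨆ b', ‖WL2.equiv ℂ _ W u b'‖) + p₂ * ‖u‖) + pK * (⨆ b', ‖WL2.equiv ℂ _ W u b'‖) :=
        add_le_add ((norm_add_le _ _).trans (add_le_add (hPΔ u b) (hP₂ u b))) (hPK u b)
      _ = (pΔ + pK) * (⨆ b', ‖WL2.equiv ℂ _ W u b'‖) + p₂ * ‖u‖ := by ring
  -- the bootstrap with `m = 1`, `p_∞ = p′_∞ + p″_∞`, `R = p₂‖u‖`
  have hboot := norm_le_of_kato_bootstrap_linf (𝕜 := ℂ) nbr (fun _ _ => (η⁻¹) ^ 2) (fun _ _ => sq_nonneg _) T hT (fun _ => c₀) one_pos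
    (hFS_bond_of_site hC₃ (le_of_lt (Fact.out : 0 < c₀)) hFS) hu hF (by linarith : 2 * (pΔ + pK) < 1) hq b
  -- the letters (E₀), (supp) in the bootstrap's currency
  have hNu : Real.sqrt (∑ y, c₀ * ‖WL2.equiv ℂ _ W u y‖ ^ 2) = ‖u‖ := (norm_eq_sqrt_sum u).symm
  have hEn : ‖u‖ ≤ CE * (Real.sqrt μ * F) := by
    rw [hu_def]; exact (hE f).trans (mul_le_mul_of_nonneg_left hμ hCE)
  have hF0 : 0 ≤ F := (norm_nonneg _).trans (hF b)
  have hden : 0 < 1 - 2 * (pΔ + pK) := by linarith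
  rw [hNu, div_one, one_pow, one_mul] at hboot
  have hden' : (1 : ℝ) - 2 * (pΔ + pK) / 1 = 1 - 2 * (pΔ + pK) := by rw [div_one]
  rw [hden'] at hboot
  refine hboot.trans ?_
  rw [div_mul_eq_mul_div, div_le_div_iff_of_pos_right hden]
  have h1 : 2 * (F + p₂ * ‖u‖) ≤ 2 * F + 2 * p₂ * (CE * (Real.sqrt μ * F)) := by nlinarith [mul_le_mul_of_nonneg_left hEn hp₂]
  have h2 : C₃ * ‖u‖ ≤ C₃ * (CE * (Real.sqrt μ * F)) := mul_le_mul_of_nonneg_left hEn hC₃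
  nlinarith [h1, h2]

/-! ## §2 (P𝒦) inhabited from the holonomy letter; (T) from the chain's standing letters -/

omit [StarRing 𝔸] [StarModule ℂ 𝔸] [FiniteDimensional ℂ W] in
/-- **(P𝒦) INHABITED**: with the HOLONOMY LETTER of `B11Eq135WeitzenbockCarrier.norm_weitzOp_apply_le` for the chain's transporters —
`‖(R(U(w,ν)⁻¹)R(U(w,μ)) − R(U(x,μ))R(U(z,ν)⁻¹))v‖ ≤ δ‖v‖` on the fibre for `μ ≠ ν`, `0 ≤ δ` (on print's class (3.35): `δ = O(α₀η²)` since
`|U(∂p) − 1| = O(α₀η²)`) — the `η⁻²𝒦` letter holds with `p″_∞ = η⁻²·(d − 1)·δ`. [cite: Balaban1985Variational, (135)–(136) p.298; Balaban1985BackgroundPropagators, (3.35) p.396] -/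
theorem hPK_of_holonomy {δ : ℝ} (hδ : 0 ≤ δ)
    (hHol : ∀ (x : TSite d Pd) (μ ν : Fin d), μ ≠ ν → ∀ v : W,
      ‖adTransportW φ (fun b => (U b)⁻¹) (unshift ν x, ν) (adTransportW φ U (unshift ν x, μ) v) -
        adTransportW φ U (x, μ) (adTransportW φ (fun b => (U b)⁻¹) (shift μ (unshift ν x), ν) v)‖ ≤ δ * ‖v‖)
    (v : BondL2K ℂ d Pd c₀ W) (b : Bond d Pd) :
    ‖WL2.equiv ℂ _ W ((((η : ℂ))⁻¹ * ((η : ℂ))⁻¹) • weitzOpK ℂ c₀ (adTransportW φ U) (adTransportW φ fun b => (U b)⁻¹) v) b‖ ≤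
      (η⁻¹ ^ 2 * ((d - 1 : ℝ) * δ)) * ⨆ b', ‖WL2.equiv ℂ _ W v b'‖ := by
  obtain ⟨x, μ⟩ := b
  have hbdd : BddAbove (Set.range fun b' => ‖WL2.equiv ℂ (fun _ : Bond d Pd => c₀) W v b'‖) := (Set.finite_range _).bddAbove
  have hsup : ∀ b', ‖WL2.equiv ℂ _ W v b'‖ ≤ ⨆ b', ‖WL2.equiv ℂ _ W v b'‖ := fun b' => le_ciSup hbdd b'
  have hRS : ∀ (b : Bond d Pd) (w : W), adTransportW φ U b (adTransportW φ (fun b => (U b)⁻¹) b w) = w := fun b w => by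
    have h := adTransportW_inv_adTransportW φ (fun b => (U b)⁻¹) b w
    simp only [inv_inv] at h
    exact h
  have hK := norm_weitzOp_apply_le (adTransportW φ U) (adTransportW φ fun b => (U b)⁻¹) (adTransportW_inv_adTransportW φ U) hRS hδ hHol
    (A := WL2.equiv ℂ _ W v) hsup x μ
  rw [WL2.equiv_smul, Pi.smul_apply, equiv_weitzOpK, norm_smul]
  have hn : ‖((η : ℂ))⁻¹ * ((η : ℂ))⁻¹‖ = η⁻¹ ^ 2 := by
    rw [norm_mul, norm_inv, Complex.norm_real, Real.norm_eq_abs, sq, ← abs_inv, ← abs_mul, abs_mul_self]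
  rw [hn, mul_assoc]
  exact mul_le_mul_of_nonneg_left hK (sq_nonneg _)

/-- **THE VALUE ROW OF `A₀⁻¹` ON THE CHAIN's CLASS, (T) AND (P𝒦) INHABITED**: unitary `U`, `*`-trace, compatible fibre norm (the chain's standing letters `hU`,
`hτ₂`, `hφ` — `B9Eq342GreenPrimeSupBound.norm_adTransportW_eq`) in place of the contraction binders, and the holonomy letter `δ` in place of `p″_∞`:
`‖(A₀⁻¹f)(b)‖ ≤ (2 + (2p₂ + C₃)·C_E·√μ)∕(1 − 2(p′_∞ + η⁻²(d−1)δ))·F`. [cite: Balaban1985BackgroundPropagators, Thm 3.3 (3.47) p.398, (3.26) p.395, (3.35) p.396; Balaban1985Variational, (134)–(136) p.298] -/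
theorem norm_localInv_apply_le_unitary (hτ₂ : ∀ X Y : 𝔸, τ (X * Y) = τ (Y * X)) (hU : ∀ b, star (U b : 𝔸) = ((U b)⁻¹ : 𝔸ˣ))
    (hφ : ∀ X Y : 𝔸, ⟪φ.symm X, φ.symm Y⟫_ℂ = τ (star X * Y))
    (A₀ : BondL2K ℂ d Pd c₀ W →ₗ[ℂ] BondL2K ℂ d Pd c₀ W)
    (hA₀ : A₀ = hessOp φ η U τ + covDerivL2K ℂ c₀ ((η : ℂ))⁻¹ (adTransportW φ U) ∘ₗ covDivL2K ℂ c₀ ((η : ℂ))⁻¹ (adTransportW φ fun b => (U b)⁻¹) +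
      LinearMap.adjoint Q ∘ₗ ((a : ℂ) • Q))
    (hpos₀ : ∀ x : BondL2K ℂ d Pd c₀ W, x ≠ 0 → 0 < RCLike.re ⟪x, A₀ x⟫_ℂ)
    {pΔ δ p₂ CE C₃ : ℝ} (hδ : 0 ≤ δ) (hp₂ : 0 ≤ p₂) (hCE : 0 ≤ CE) (hC₃ : 0 ≤ C₃) (hsmall : 2 * (pΔ + η⁻¹ ^ 2 * ((d - 1 : ℝ) * δ)) < 1)
    (hPΔ : ∀ (v : BondL2K ℂ d Pd c₀ W) (b : Bond d Pd),
      ‖WL2.equiv ℂ _ W (curvOp φ τ η U v) b‖ ≤ pΔ * ⨆ b', ‖WL2.equiv ℂ _ W v b'‖)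
    (hHol : ∀ (x : TSite d Pd) (μ ν : Fin d), μ ≠ ν → ∀ v : W,
      ‖adTransportW φ (fun b => (U b)⁻¹) (unshift ν x, ν) (adTransportW φ U (unshift ν x, μ) v) -
        adTransportW φ U (x, μ) (adTransportW φ (fun b => (U b)⁻¹) (shift μ (unshift ν x), ν) v)‖ ≤ δ * ‖v‖)
    (hP₂ : ∀ (v : BondL2K ℂ d Pd c₀ W) (b : Bond d Pd), ‖WL2.equiv ℂ _ W ((LinearMap.adjoint Q ∘ₗ ((a : ℂ) • Q)) v) b‖ ≤ p₂ * ‖v‖)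
    (hE : ∀ g, ‖greenK A₀ hpos₀ g‖ ≤ CE * ‖g‖)
    (hFS : ∀ ψ φ₁ φ₂ : TSite d Pd → ℝ, (∀ x, 0 ≤ ψ x) →
      (∀ x, ∑ j : Fin d ⊕ Fin d, (η⁻¹) ^ 2 * (φ₁ x - φ₁ (Sum.elim (fun ν => unshift ν x) (fun ν => shift ν x) j)) + 1 * φ₁ x = ψ x) →
      (∀ x, ∑ j : Fin d ⊕ Fin d, (η⁻¹) ^ 2 * (φ₂ x - φ₂ (Sum.elim (fun ν => unshift ν x) (fun ν => shift ν x) j)) + 1 * φ₂ x = φ₁ x) →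
      ∀ x, φ₂ x ≤ C₃ * Real.sqrt (∑ y, c₀ * ψ y ^ 2))
    (f : BondL2K ℂ d Pd c₀ W) {F μ : ℝ} (hF : ∀ b, ‖WL2.equiv ℂ _ W f b‖ ≤ F) (hμ : ‖f‖ ≤ Real.sqrt μ * F) (b : Bond d Pd) :
    ‖WL2.equiv ℂ _ W (greenK A₀ hpos₀ f) b‖ ≤
      (2 + (2 * p₂ + C₃) * CE * Real.sqrt μ) / (1 - 2 * (pΔ + η⁻¹ ^ 2 * ((d - 1 : ℝ) * δ))) * F :=
  norm_localInv_apply_le φ η U τ Q a (fun b w => (norm_adTransportW_eq φ U τ hτ₂ hU hφ b w).le)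
    (fun b w => (norm_adTransportW_inv_eq φ U τ hτ₂ hU hφ b w).le) A₀ hA₀ hpos₀ hp₂ hCE hC₃ hsmall hPΔ
    (hPK_of_holonomy φ η U hδ hHol) hP₂ hE hFS f hF hμ b

end Instance

end Literature.MathematicalPhysics.QuantumFieldTheory.Balaban1983to89.B9Eq326LocalPartSupBound

end
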